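/-
Copyright (c) 2026 the pub-hodgecm-mathlib formalisation cell (harness21).  R90-TF SLAB, section S10 (Rogawski 1990, §13.8 Prop. 13.8.3 read at `v`),
prover R90-C138-p03 (g2) — road (R1)″ of (M-a) (RULING J-Ma-2′, dealer R90-C138-plan (g3)), bricks (P2)+(P3): compact subgroups of the centralisers of
`H_w = U(Φ₂)_w × U(Φ₁)_w` are INTEGRAL at a SPLIT place; h413 = `stmt-HodgeConjecture-24833`, route `HCCMUnconditional`.
-/
import Literature.NumberTheory.Automorphic.UnitaryGroupTorusOrbitalIntegralCanonicalH     -- ★ FILE 2′ (the non-split template) + its cone: ★ C1 `subgroup_le_glInt_of_isCompact_of_le_centralizer_diagonal`, ★ C′₁ `TorusDescentProd`, carriers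
import Literature.NumberTheory.Automorphic.LocalStableConjSplitPlace                       -- ★ `coe_localSplitEquiv_apply` (the split-place one-place model `U(J)(F_v) ≃ₜ* GL_N(E_w)`)
import Literature.NumberTheory.Automorphic.OrbitalMeasureCanonicalExistsCM                 -- ★ `compactCore_centralizer_local_facts_of_isRegularElt` (both places)
import Literature.NumberTheory.Automorphic.UnitOrbitalIntegralFixedPointsPair              -- ★ `cmLocalIntegralLevel_one_eq_top_of_smul_eq` (non-split: `K₁ = ⊤`)
import HarnessLib

/-!
# R90-TF ∕ S10 — road (R1)″ of (M-a), bricks (P2)+(P3): at a SPLIT place the compact subgroups of `Z(t) ≤ U(Φ₂)(L⁺_v)` (`t` regular diagonal) lie in `U(Φ₂)(𝒪_v)`,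
# and the compact subgroups of `U(Φ₁)(L⁺_v)` lie in `U(Φ₁)(𝒪_v)` (every place); hence `compactCore Z(t, u) ⊆ K₂ × K₁` on `H_v`
# (`Theorems/R90S10CompactSubgroupsIntegralLevelSplit.lean`; ns `Summit.HodgeConjecture.HodgeConjecture.R90.S10`; lane `--supports stmt-HodgeConjecture-24833`)

Cell `hodgecm-mathlib`, crux H413 (`stmt-HodgeConjecture-24833`), route of record `HCCMUnconditional`; programme R90-TF, section S10 (base `R90-C138`).
PROOF lane: theorems only (no `def`, no instance, no notation, no named fact, no `sorry`); ★-only imports (law L9).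

WHY.  The (M-a) payer road (R1)″ (`R90/R90-C138-p03/g2/FHEADS-Ma-R1pp.md`, dealer RULING J-Ma-2′) ports the ★ H-side orbital machinery to a SPLIT place.  Its
file F1″ (split twin of ★ FILE 2′ `classOrbitalIntegral_prod_eq_smul_integral_prod_of_torus_regular_of_nonsplit`) identifies the member of a CANONICAL orbital family at
the class of `(t, u)` with the quotient measure `ν_H ∕ t_Z`, `t_Z` the Haar measure on `Z(t, u)` with mass one on its COMPACT CORE; this needs
`compactCore Z(t, u) ⊆ K₂ × K₁` (★ `compactCore_eq_preimage_of_subset`).  ★ FILE 2′ proves it at a NON-split place through the one-place FIELD model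
★ `localNonsplitEquiv` (and `K₁ = U(Φ₁)_v`, compact).  THIS FILE proves the SPLIT twins through the split one-place model ★ `localSplitEquiv : U(J)(F_v) ≃ₜ* GL_N(E_w)`:
* §1 (P3) **`subgroup_le_cmLocalIntegralLevel_two_of_isCompact_of_le_centralizer_of_split`** — at `w ∣ v` with `c • w ≠ w`, for `t = diag(d₀, d₁) ∈ U(Φ₂)(L⁺_v)` regular
  (`d₀⁻¹d₁ − 1` a unit), every compact subgroup `C ≤ Z(t)` lies in `K₂ = U(Φ₂)(𝒪_v)`: `localSplitEquiv t` is the REGULAR diagonal `diag(d₀(w), d₁(w))` of `GL₂(L_w)`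
  (★ `coe_localSplitEquiv_apply`), so `localSplitEquiv(C)` — compact, inside the centraliser — is diagonal with bounded, hence integral, entries (★ C1
  `subgroup_le_glInt_of_isCompact_of_le_centralizer_diagonal`), and `U(Φ₂)(𝒪_v) = localSplitEquiv⁻¹ GL₂(𝒪_w)` (★ `mem_localIntegralLevel_iff_of_ne`, `Φ₂` hyperspecial ★
  `unit_placeForm_antidiagOne_mem_glInt`);
* §2 (P2) **`subgroup_le_cmLocalIntegralLevel_one_of_isCompact`** — at EVERY place, every compact subgroup of `U(Φ₁)(L⁺_v)` lies in `K₁ = U(Φ₁)(𝒪_v)` (non-split: `K₁ = ⊤`,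
  ★ `cmLocalIntegralLevel_one_eq_top_of_smul_eq`; split: ★ C1 at `N = 1` around `γ = 1`);
* §3 **`compactCore_centralizer_subset_prod_of_split`** — the generic product step ★ C′₁ `TorusDescentProd.compactCore_subset_preimage_prod` re-proved with `hK₁ : ∀ x, x ∈ K₁`
  weakened to «compact subgroups of `U` lie in `K₁`» (`compactCore_subset_preimage_prod_of_forall_isCompact`), then read on `H_v` at a split place:
  `compactCore Z(t, u) ⊆ K₂ × K₁` — the `hcore` input of F1″, TOKEN-COMPATIBLE with ★ FILE 2′ :177.
[Rogawski1990 §4.3 (4.3.1) p. 43 «compatible measures», §4.9 p. 55, §14.2 p. 232; Tits 1979 §3.8; PlatonovRapinchuk1994 §5.1, §3.3.]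
HONEST LABEL: bricks of an L-sized road; they pay no socket; HC_CM is proved only modulo the 7 printed citations (2 remaining named inputs: hLiu418 =
`stmt-HodgeConjecture-24832`, h413 = `stmt-HodgeConjecture-24833`) until rung 0 closes; REL ≠ ★ ≠ BUILT; count-neutral.

## References
* [Rogawski1990] J. D. Rogawski, *Automorphic Representations of Unitary Groups in Three Variables*, Ann. of Math. Stud. 123 (1990), §4.3 (4.3.1) p. 43; §4.9 p. 55;
  §14.2 p. 232.
* [PlatonovRapinchuk1994] V. Platonov, A. Rapinchuk, *Algebraic Groups and Number Theory* (1994), §3.3, §5.1.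
* [Tits1979] J. Tits, *Reductive groups over local fields*, PSPM 33.1 (1979), §3.8.
-/

set_option autoImplicit false
set_option linter.dupNamespace false

noncomputable section

open MeasureTheory Measure Set Filter Topology NumberField IsDedekindDomain
open Literature.MeasureTheory.Group
open Literature.NumberTheory.Automorphic Literature.NumberTheory.Automorphic.UnitaryGroup Literature.NumberTheory.Automorphic.TorusDescentProd
open Literature.NumberTheory.Rogawski1990 (IsRegularElt)
open scoped ENNReal NNReal Matrix MatrixGroups

namespace Summit.HodgeConjecture.HodgeConjecture.R90.S10

/-! ## §1 (P3) compact subgroups of the centraliser of a regular diagonal `t ∈ U(Φ₂)(L⁺_v)` are integral, SPLIT place -/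

section TwoSplit

variable (L : Type) [Field L] [NumberField L] [IsCMField L] {v : HeightOneSpectrum (𝓞 ↥(maximalRealSubfield L))}

/-- **(P3) At a SPLIT place, compact subgroups of `Z(t)` are integral** for `t = diag(d₀, d₁) ∈ U(Φ₂)(L⁺_v)` with `d₀⁻¹d₁ − 1` a unit: every compact subgroup
`C ≤ Z(t)` of `U(Φ₂)(L⁺_v)` lies in `K₂ = U(Φ₂)(𝒪_v)` — the split twin of ★ FILE 2′'s `hint` (:156–:176, ★ `localNonsplitEquiv`), through ★ `localSplitEquiv`.
[cite: Rogawski1990, §4.3 (4.3.1) p. 43; §14.2 p. 232] [cite: PlatonovRapinchuk1994, §3.3 and §5.1] -/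
theorem subgroup_le_cmLocalIntegralLevel_two_of_isCompact_of_le_centralizer_of_split
    (w : PlacesOver L v) (hw : IsCMField.complexConj L • w.1 ≠ w.1)
    {γ₂ : (cmDatum L 2 (Matrix.of fun i j : Fin 2 => if i.val + j.val + 1 = 2 then (1 : L) else 0)).Local v} {d : Fin 2 → (LocalRing L v)ˣ}
    (hd : glDiagonal 2 (LocalRing L v) d = (γ₂.val : GL (Fin 2) (LocalRing L v)))
    (hb : IsUnit ((((d 0)⁻¹ * d 1 : (LocalRing L v)ˣ) : LocalRing L v) - 1))
    (C : Subgroup ((cmDatum L 2 (Matrix.of fun i j : Fin 2 => if i.val + j.val + 1 = 2 then (1 : L) else 0)).Local v))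
    (hC : IsCompact (C : Set ((cmDatum L 2 (Matrix.of fun i j : Fin 2 => if i.val + j.val + 1 = 2 then (1 : L) else 0)).Local v)))
    (hCZ : C ≤ Subgroup.centralizer ({γ₂} : Set ((cmDatum L 2 (Matrix.of fun i j : Fin 2 => if i.val + j.val + 1 = 2 then (1 : L) else 0)).Local v))) :
    C ≤ cmLocalIntegralLevel L 2 (Matrix.of fun i j : Fin 2 => if i.val + j.val + 1 = 2 then (1 : L) else 0) v := by
  have hc := IsCMField.complexConj_ne_one L
  haveI : Algebra.IsQuadraticExtension ↥(maximalRealSubfield L) L := IsCMField.isQuadraticExtension L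
  have hΦ₂ := antidiagOne_map_transpose (IsCMField.complexConj L) 2
  have hJw := isUnit_placeForm_antidiagOne (E := L) 2 w.1
  have hJi := unit_placeForm_antidiagOne_mem_glInt (E := L) 2 w.1
  -- regularity of `diag(d)`: all-pairs form, then at the place `w`
  have h10 : IsUnit ((d 1 : LocalRing L v) - d 0) := by
    have h := (d 0).isUnit.mul hb
    rwa [mul_sub, mul_one, Units.val_mul, Units.mul_inv_cancel_left] at h
  have hregd : ∀ i j : Fin 2, i ≠ j → IsUnit ((d i : LocalRing L v) - d j) := by
    intro i j hij
    fin_cases i <;> fin_cases j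
    · exact absurd rfl hij
    · simpa using h10.neg
    · exact h10
    · exact absurd rfl hij
  have hdw : ∀ i j : Fin 2, i ≠ j → IsUnit (((d i : (LocalRing L v)ˣ) : LocalRing L v) w - ((d j : (LocalRing L v)ˣ) : LocalRing L v) w) := by
    intro i j hij
    have h1 := (hregd i j hij).map (Pi.evalRingHom (fun w' : PlacesOver L v => w'.1.adicCompletion L) w)
    rwa [map_sub] at h1
  -- the split one-place model `e = localSplitEquiv : U(Φ₂)(L⁺_v) ≃ₜ* GL₂(L_w)` sends `t` to the regular diagonal `diag(d(w))`
  have hγ₂w : ((localSplitEquiv (IsCMField.complexConj L) (Matrix.of fun i j : Fin 2 => if i.val + j.val + 1 = 2 then (1 : L) else 0) hc hΦ₂ w hw hJw γ₂ :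
        GL (Fin 2) (w.1.adicCompletion L)) : Matrix (Fin 2) (Fin 2) (w.1.adicCompletion L)) =
      Matrix.diagonal fun i => ((d i : (LocalRing L v)ˣ) : LocalRing L v) w := by
    rw [coe_localSplitEquiv_apply, ← hd, coe_glDiagonal,
      Matrix.diagonal_map (RingHom.map_zero (Pi.evalRingHom (fun w' : PlacesOver L v => w'.1.adicCompletion L) w))]
    rfl
  intro x hxC
  let φ' : ((cmDatum L 2 (Matrix.of fun i j : Fin 2 => if i.val + j.val + 1 = 2 then (1 : L) else 0)).Local v) →* GL (Fin 2) (w.1.adicCompletion L) :=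
    (localSplitEquiv (IsCMField.complexConj L) (Matrix.of fun i j : Fin 2 => if i.val + j.val + 1 = 2 then (1 : L) else 0) hc hΦ₂ w hw hJw).toMulEquiv.toMonoidHom
  have hφ' : Continuous φ' :=
    (localSplitEquiv (IsCMField.complexConj L) (Matrix.of fun i j : Fin 2 => if i.val + j.val + 1 = 2 then (1 : L) else 0) hc hΦ₂ w hw hJw).continuous
  have hCc : IsCompact ((C.map φ' : Subgroup (GL (Fin 2) (w.1.adicCompletion L))) : Set (GL (Fin 2) (w.1.adicCompletion L))) := by
    rw [Subgroup.coe_map]; exact hC.image hφ'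
  have hCZ' : C.map φ' ≤ Subgroup.centralizer ({φ' γ₂} : Set (GL (Fin 2) (w.1.adicCompletion L))) := by
    rintro _ ⟨y, hy, rfl⟩
    rw [Subgroup.mem_centralizer_singleton_iff, ← map_mul, ← map_mul, Subgroup.mem_centralizer_singleton_iff.1 (hCZ hy)]
  have hle := subgroup_le_glInt_of_isCompact_of_le_centralizer_diagonal 2 (w.1) hγ₂w hdw _ hCc hCZ'
  exact (mem_localIntegralLevel_iff_of_ne (IsCMField.complexConj L) 2 (Matrix.of fun i j : Fin 2 => if i.val + j.val + 1 = 2 then (1 : L) else 0)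
    hc hΦ₂ w hw hJw hJi x).2 (hle ⟨x, hxC, rfl⟩)

end TwoSplit

/-! ## §2 (P2) compact subgroups of `U(Φ₁)(L⁺_v)` are integral, EVERY place -/

section One

variable (L : Type) [Field L] [NumberField L] [IsCMField L] {v : HeightOneSpectrum (𝓞 ↥(maximalRealSubfield L))}

/-- **(P2) Compact subgroups of `U(Φ₁)(L⁺_v)` lie in `K₁ = U(Φ₁)(𝒪_v)`, at every finite place**: at a non-split place `K₁` is the whole (compact) group (★
`cmLocalIntegralLevel_one_eq_top_of_smul_eq`); at a split place `U(Φ₁)(L⁺_v) ≃ₜ* GL₁(L_w)` (★ `localSplitEquiv`) and a compact subgroup of `GL₁(L_w)` has integral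
entries (★ C1 at `N = 1`, around `γ = 1`).  So `compactCore U(Φ₁)(L⁺_v) = K₁` — the split-place substitute for ★ FILE 2′'s `hK₁ : U(Φ₁)(L⁺_v) ⊆ K₁`.
[cite: Rogawski1990, §4.3 (4.3.1) p. 43; §4.9 p. 55] [cite: PlatonovRapinchuk1994, §3.3 and §5.1] -/
theorem subgroup_le_cmLocalIntegralLevel_one_of_isCompact
    (C : Subgroup ((cmDatum L 1 (Matrix.of fun i j : Fin 1 => if i.val + j.val + 1 = 1 then (1 : L) else 0)).Local v))
    (hC : IsCompact (C : Set ((cmDatum L 1 (Matrix.of fun i j : Fin 1 => if i.val + j.val + 1 = 1 then (1 : L) else 0)).Local v))) :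
    C ≤ cmLocalIntegralLevel L 1 (Matrix.of fun i j : Fin 1 => if i.val + j.val + 1 = 1 then (1 : L) else 0) v := by
  have hc := IsCMField.complexConj_ne_one L
  haveI : Algebra.IsQuadraticExtension ↥(maximalRealSubfield L) L := IsCMField.isQuadraticExtension L
  obtain ⟨w⟩ := (inferInstance : Nonempty (PlacesOver L v))
  by_cases hw : IsCMField.complexConj L • w.1 = w.1
  · -- non-split: `K₁ = ⊤`
    rw [cmLocalIntegralLevel_one_eq_top_of_smul_eq L _ w hw (isUnit_placeForm_antidiagOne (E := L) 1 w.1)]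
    exact le_top
  · -- split: through `GL₁(L_w)`
    have hΦ₁ := antidiagOne_map_transpose (IsCMField.complexConj L) 1
    have hJw := isUnit_placeForm_antidiagOne (E := L) 1 w.1
    have hJi := unit_placeForm_antidiagOne_mem_glInt (E := L) 1 w.1
    intro x hxC
    let φ' : ((cmDatum L 1 (Matrix.of fun i j : Fin 1 => if i.val + j.val + 1 = 1 then (1 : L) else 0)).Local v) →* GL (Fin 1) (w.1.adicCompletion L) :=
      (localSplitEquiv (IsCMField.complexConj L) (Matrix.of fun i j : Fin 1 => if i.val + j.val + 1 = 1 then (1 : L) else 0) hc hΦ₁ w hw hJw).toMulEquiv.toMonoidHom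
    have hφ' : Continuous φ' :=
      (localSplitEquiv (IsCMField.complexConj L) (Matrix.of fun i j : Fin 1 => if i.val + j.val + 1 = 1 then (1 : L) else 0) hc hΦ₁ w hw hJw).continuous
    have hCc : IsCompact ((C.map φ' : Subgroup (GL (Fin 1) (w.1.adicCompletion L))) : Set (GL (Fin 1) (w.1.adicCompletion L))) := by
      rw [Subgroup.coe_map]; exact hC.image hφ'
    -- everything centralises `1 = diag(1)`, which is (vacuously) regular at `N = 1`
    have h1 : (((1 : GL (Fin 1) (w.1.adicCompletion L)) : Matrix (Fin 1) (Fin 1) (w.1.adicCompletion L))) =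
        Matrix.diagonal fun _ : Fin 1 => (1 : w.1.adicCompletion L) := by
      rw [Units.val_one, Matrix.diagonal_one]
    have hd1 : ∀ i j : Fin 1, i ≠ j → IsUnit ((fun _ : Fin 1 => (1 : w.1.adicCompletion L)) i - (fun _ : Fin 1 => (1 : w.1.adicCompletion L)) j) :=
      fun i j hij => absurd (Subsingleton.elim i j) hij
    have hCZ' : C.map φ' ≤ Subgroup.centralizer ({(1 : GL (Fin 1) (w.1.adicCompletion L))} : Set (GL (Fin 1) (w.1.adicCompletion L))) :=
      fun y _ => Subgroup.mem_centralizer_singleton_iff.2 (by rw [mul_one, one_mul])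
    have hle := subgroup_le_glInt_of_isCompact_of_le_centralizer_diagonal 1 (w.1) h1 hd1 _ hCc hCZ'
    exact (mem_localIntegralLevel_iff_of_ne (IsCMField.complexConj L) 1 (Matrix.of fun i j : Fin 1 => if i.val + j.val + 1 = 1 then (1 : L) else 0)
      hc hΦ₁ w hw hJw hJi x).2 (hle ⟨x, hxC, rfl⟩)

end One

/-! ## §3 The product step with a NON-compact abelian second factor, and the `H_v`-reading at a split place -/

section Core

variable {A U : Type*} [Group A] [Group U] [TopologicalSpace A] [TopologicalSpace U]
  {T K₂ : Subgroup A} {K₁ : Subgroup U} {Z : Subgroup (A × U)} (hZ : ∀ g : A × U, g ∈ Z ↔ g.1 ∈ T)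

include hZ in
/-- **`compactCore Z ⊆ K₂ × K₁`** when every compact subgroup of `T` lies in `K₂` and every compact subgroup of `U` lies in `K₁` (★ C′₁
`TorusDescentProd.compactCore_subset_preimage_prod` with its `hK₁ : K₁ = U` weakened): a compact subgroup of `Z = T × U` projects to compact subgroups of `T`
and of `U`. [cite: Rogawski1990, §4.3 p. 43] -/
theorem compactCore_subset_preimage_prod_of_forall_isCompact
    (hint : ∀ C : Subgroup A, IsCompact (C : Set A) → C ≤ T → C ≤ K₂) (hint₁ : ∀ C : Subgroup U, IsCompact (C : Set U) → C ≤ K₁) :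
    compactCore ↥Z ⊆ Subtype.val ⁻¹' ((K₂.prod K₁ : Subgroup (A × U)) : Set (A × U)) := by
  intro z hz
  obtain ⟨C₀, hC₀, hzC₀⟩ := (mem_compactCore_iff z).1 hz
  let π : ↥Z →* A := (MonoidHom.fst A U).comp Z.subtype
  have hπ : Continuous π := continuous_fst.comp continuous_subtype_val
  have hC : IsCompact ((C₀.map π : Subgroup A) : Set A) := by rw [Subgroup.coe_map]; exact hC₀.image hπ
  have hCT : C₀.map π ≤ T := by
    rintro _ ⟨c, -, rfl⟩
    exact (hZ (c : A × U)).1 c.2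
  let π₁ : ↥Z →* U := (MonoidHom.snd A U).comp Z.subtype
  have hπ₁ : Continuous π₁ := continuous_snd.comp continuous_subtype_val
  have hC₁ : IsCompact ((C₀.map π₁ : Subgroup U) : Set U) := by rw [Subgroup.coe_map]; exact hC₀.image hπ₁
  exact Subgroup.mem_prod.2 ⟨hint _ hC hCT ⟨z, hzC₀, rfl⟩, hint₁ _ hC₁ ⟨z, hzC₀, rfl⟩⟩

end Core

section HSplit

variable (L : Type) [Field L] [NumberField L] [IsCMField L] {v : HeightOneSpectrum (𝓞 ↥(maximalRealSubfield L))}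

/-- **`compactCore Z(t, u) ⊆ K₂ × K₁` on `H_v = U(Φ₂)(L⁺_v) × U(Φ₁)(L⁺_v)` at a SPLIT place**, for `t = diag(d₀, d₁)` regular and any `u`: the centraliser of `(t, u)` is
`Z(t) × U(Φ₁)_v` (`U(Φ₁)` abelian, ★ `mul_comm_cmDatum_local_one`), its compact subgroups project into `K₂` (§1) and `K₁` (§2) — the `hcore` input of F1″ in the
token shape of ★ FILE 2′ :177. [cite: Rogawski1990, §4.3 (4.3.1) p. 43; §4.9 p. 55] [cite: PlatonovRapinchuk1994, §3.3] -/
theorem compactCore_centralizer_subset_prod_of_split (w : PlacesOver L v) (hw : IsCMField.complexConj L • w.1 ≠ w.1)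
    {γ₂ : (cmDatum L 2 (Matrix.of fun i j : Fin 2 => if i.val + j.val + 1 = 2 then (1 : L) else 0)).Local v} {d : Fin 2 → (LocalRing L v)ˣ}
    (hd : glDiagonal 2 (LocalRing L v) d = (γ₂.val : GL (Fin 2) (LocalRing L v)))
    (hb : IsUnit ((((d 0)⁻¹ * d 1 : (LocalRing L v)ˣ) : LocalRing L v) - 1))
    (γ₁ : (cmDatum L 1 (Matrix.of fun i j : Fin 1 => if i.val + j.val + 1 = 1 then (1 : L) else 0)).Local v) :
    compactCore ↥(Subgroup.centralizer ({(γ₂, γ₁)} : Set ((cmDatum L 2 (Matrix.of fun i j : Fin 2 => if i.val + j.val + 1 = 2 then (1 : L) else 0)).Local v ×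
        (cmDatum L 1 (Matrix.of fun i j : Fin 1 => if i.val + j.val + 1 = 1 then (1 : L) else 0)).Local v))) ⊆
      Subtype.val ⁻¹' (((cmLocalIntegralLevel L 2 (Matrix.of fun i j : Fin 2 => if i.val + j.val + 1 = 2 then (1 : L) else 0) v).prod
        (cmLocalIntegralLevel L 1 (Matrix.of fun i j : Fin 1 => if i.val + j.val + 1 = 1 then (1 : L) else 0) v) :
        Subgroup ((cmDatum L 2 (Matrix.of fun i j : Fin 2 => if i.val + j.val + 1 = 2 then (1 : L) else 0)).Local v ×
          (cmDatum L 1 (Matrix.of fun i j : Fin 1 => if i.val + j.val + 1 = 1 then (1 : L) else 0)).Local v)) :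
        Set ((cmDatum L 2 (Matrix.of fun i j : Fin 2 => if i.val + j.val + 1 = 2 then (1 : L) else 0)).Local v ×
          (cmDatum L 1 (Matrix.of fun i j : Fin 1 => if i.val + j.val + 1 = 1 then (1 : L) else 0)).Local v)) := by
  have hU := mul_comm_cmDatum_local_one L v
  have hZ' : ∀ g : ((cmDatum L 2 (Matrix.of fun i j : Fin 2 => if i.val + j.val + 1 = 2 then (1 : L) else 0)).Local v ×
      (cmDatum L 1 (Matrix.of fun i j : Fin 1 => if i.val + j.val + 1 = 1 then (1 : L) else 0)).Local v),
      g ∈ Subgroup.centralizer ({(γ₂, γ₁)} : Set ((cmDatum L 2 (Matrix.of fun i j : Fin 2 => if i.val + j.val + 1 = 2 then (1 : L) else 0)).Local v ×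
        (cmDatum L 1 (Matrix.of fun i j : Fin 1 => if i.val + j.val + 1 = 1 then (1 : L) else 0)).Local v)) ↔
        g.1 ∈ Subgroup.centralizer ({γ₂} : Set ((cmDatum L 2 (Matrix.of fun i j : Fin 2 => if i.val + j.val + 1 = 2 then (1 : L) else 0)).Local v)) := by
    intro g
    rw [Subgroup.mem_centralizer_singleton_iff, Subgroup.mem_centralizer_singleton_iff, Prod.ext_iff, Prod.fst_mul, Prod.fst_mul,
      Prod.snd_mul, Prod.snd_mul]
    exact ⟨fun h => h.1, fun h => ⟨h, hU _ _⟩⟩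
  exact compactCore_subset_preimage_prod_of_forall_isCompact hZ'
    (fun C hC hCZ => subgroup_le_cmLocalIntegralLevel_two_of_isCompact_of_le_centralizer_of_split L w hw hd hb C hC hCZ)
    (fun C hC => subgroup_le_cmLocalIntegralLevel_one_of_isCompact L C hC)

end HSplit

end Summit.HodgeConjecture.HodgeConjecture.R90.S10

end
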